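import Summits.MatrixMultiplication.OmegaCensus.C2PowSemidirectZ4Law
import HarnessLib

/-!
# `3 ∣ |A|`: the general law lifts along `C₂^k × –` — `β(C₂^k × G) = 2^k β(G)` whenever `G` attains `3V = 8|A|`

ω-census, family (b3).  Framing: lottery ticket; floor = certified bounds/negative ranges.

For a dihedral-like group `G` presented over `A`, `C₂^k × G` is presented over `𝔽₂^k × A` (`c2pow_product_presentation`), so the
general law `3|S||T||U| ≤ 8 · 2^k |A|` holds there; if `G` has a triple with `3|S||T||U| = 8|A|` (possible only when
`3 ∣ |A|`), then `(C₂^k, 1, 1) ×` it attains the lifted law: **`c2pow_general_law`**.  This is the uniform statement behind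
`c2pow_quaternion_law` and `c2pow_semidirect_law`, and applies verbatim to `D_{2n}`, `C₂ × D_{2n}`, `Dih(A)`, … with `3 ∣ |A|`.
-/

namespace Summit.MatrixMultiplication.OmegaCensus

open Literature.Combinatorics.Additive Finset
open Summit.MatrixMultiplication.MatrixMultiplication.Theorems.JuntaBranch.Planting (tpp_product)

section Lift

variable {A : Type*} [AddCommGroup A] [Fintype A] [DecidableEq A] {G : Type} [Group G] [DecidableEq G]
  {ρ τ : A → G} {c₀ : A} {k : ℕ}

/-- **`β(C₂^k × G) = 2^k · 8|A|/3` when the dihedral-like group `G = G(A, c₀)` attains the general law `3V = 8|A|`.**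
[folklore] -/
theorem c2pow_general_law
    (hρρ : ∀ a b, ρ a * ρ b = ρ (a + b)) (hρτ : ∀ a b, ρ a * τ b = τ (b - a))
    (hτρ : ∀ a b, τ a * ρ b = τ (a + b)) (hττ : ∀ a b, τ a * τ b = ρ (c₀ + b - a))
    (hρ : Function.Injective ρ) (hτ : Function.Injective τ) (hne : ∀ a b, ρ a ≠ τ b)
    (hsurj : ∀ g, (∃ a, ρ a = g) ∨ (∃ a, τ a = g))
    (hex : ∃ S T U : Finset G, TripleProductProperty S T U ∧ 3 * (S.card * T.card * U.card) = 8 * Fintype.card A) :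
    (∀ S T U : Finset (Multiplicative (Fin k → ZMod 2) × G), TripleProductProperty S T U →
        3 * (S.card * T.card * U.card) ≤ 2 ^ k * (8 * Fintype.card A)) ∧
    ∃ S T U : Finset (Multiplicative (Fin k → ZMod 2) × G), TripleProductProperty S T U ∧
      3 * (S.card * T.card * U.card) = 2 ^ k * (8 * Fintype.card A) := by
  refine ⟨fun S T U h => ?_, ?_⟩
  · refine c2pow_product_presentation (k := k) hρρ hρτ hτρ hττ hρ hτ hne hsurj
      fun ρ' τ' c₀' hρρ' hρτ' hτρ' hττ' hρ' hτ' hne' hsurj' _ => ?_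
    have key := tpp_volume_le_of_dihedralLike hρρ' hρτ' hτρ' hττ' hρ' hτ' hne' hsurj' h
    rw [Fintype.card_prod, Fintype.card_fun, ZMod.card, Fintype.card_fin] at key
    calc 3 * (S.card * T.card * U.card) ≤ 8 * (2 ^ k * Fintype.card A) := key
      _ = 2 ^ k * (8 * Fintype.card A) := by ring
  · obtain ⟨S, T, U, h, hvol⟩ := hex
    refine ⟨univ ×ˢ S, {1} ×ˢ T, {1} ×ˢ U, tpp_product tpp_univ_one_one h, ?_⟩
    rw [card_product, card_product, card_product, card_univ, card_singleton, Fintype.card_multiplicative,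
      Fintype.card_fun, ZMod.card, Fintype.card_fin]
    calc 3 * (2 ^ k * S.card * (1 * T.card) * (1 * U.card)) = 2 ^ k * (3 * (S.card * T.card * U.card)) := by ring
      _ = 2 ^ k * (8 * Fintype.card A) := by rw [hvol]

/-- Example: **`β(C₂^k × D_{2n}) = 2^k · 8n/3 = 2^k β(D_{2n})` for `3 ∣ n`, `n ≥ 3`** (`D_{2n} = G(ℤ_n, 0)`; the dihedral
family attains `3V = 8n`). [folklore] -/
theorem c2pow_dihedral_law {n : ℕ} [NeZero n] (hn : 3 ≤ n) (h3 : 3 ∣ n) :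
    (∀ S T U : Finset (Multiplicative (Fin k → ZMod 2) × DihedralGroup n), TripleProductProperty S T U →
        3 * (S.card * T.card * U.card) ≤ 2 ^ k * (8 * n)) ∧
    ∃ S T U : Finset (Multiplicative (Fin k → ZMod 2) × DihedralGroup n), TripleProductProperty S T U ∧
      3 * (S.card * T.card * U.card) = 2 ^ k * (8 * n) := by
  have hex : ∃ S T U : Finset (DihedralGroup n), TripleProductProperty S T U ∧
      3 * (S.card * T.card * U.card) = 8 * Fintype.card (ZMod n) := by
    obtain ⟨S, T, U, h, -, -, -, hvol⟩ := dihedral_volume_ge_law n hn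
    refine ⟨S, T, U, h, ?_⟩
    rw [hvol, ZMod.card]
    obtain ⟨q, rfl⟩ := h3
    rw [show 2 * (3 * q) = 3 * (2 * q) by ring, Nat.mul_div_cancel_left _ (by norm_num)]
    ring
  have key := c2pow_general_law (k := k) (A := ZMod n) (G := DihedralGroup n)
    (ρ := fun i : ZMod n => DihedralGroup.r i) (τ := fun i : ZMod n => DihedralGroup.sr i) (c₀ := 0)
    (fun a b => DihedralGroup.r_mul_r a b) (fun a b => DihedralGroup.r_mul_sr a b)
    (fun a b => DihedralGroup.sr_mul_r a b) (fun a b => by rw [DihedralGroup.sr_mul_sr, zero_add])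
    (fun a b h => DihedralGroup.r.inj h) (fun a b h => DihedralGroup.sr.inj h) (fun a b h => by cases h)
    (fun g => by
      cases g with
      | r i => exact Or.inl ⟨i, rfl⟩
      | sr i => exact Or.inr ⟨i, rfl⟩)
    hex
  rw [ZMod.card] at key
  exact key

end Lift

end Summit.MatrixMultiplication.OmegaCensus
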